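import Mathlib.Analysis.Normed.Module.Basic
import Mathlib.Topology.Baire.CompleteMetrizable
import Mathlib.Topology.Baire.Lemmas
import Mathlib.Topology.MetricSpace.Basic

/-!
# Automatic uniformity of a tilt range (Baire category)
(crux stmt-AtomisticToContinuum-14440 `TwoClocks.EquilibriumFastWindowLD`, line `Sketch`; lead c4)

Helper file (`--supports stmt-AtomisticToContinuum-14440`), pure functional analysis. The crux
`EquilibriumFastWindowLD` gives, for every admissible one-body observable `F`, SOME tilt range
`β₀(F) > 0` on which the window large-deviation bound holds; the bounded-class normal form `W` of the
line `Sketch` (hypothesis of `EquilibriumFastWindowLD_of_boundedWindowLD`) asks for a tilt range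
UNIFORM over weighted sup-norm balls. This file isolates the abstract mechanism by which the former
forces the latter.

`exists_uniform_range_of_baire`: let `E` be a real Banach space, `S ⊆ E` a closed subset containing
`0` and stable under `+`, `-` and real scalings, and `P : ℝ → E → Prop` ("the bound holds on the tilt
range `b` for the observable `v`") such that
* (cover) every `v ∈ S` has some range `b > 0` with `P b v`;
* (antitone) `P b v → P b' v` for `0 < b' ≤ b`;
* (closure) if `v ∈ S` is approximable in norm by elements `w ∈ S` with `P b w`, then `P (b/2) v`;
* (sum) `P b v → P b w → P (b/2) (v + w)`;
* (symmetry) `P b v → P b (-v)`;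
* (scaling) `P b v → P (b/c) (c • v)` for `c > 0`.
Then the range is uniform on balls: `∀ C ≥ 0 ∃ b > 0 ∀ v ∈ S, ‖v‖ ≤ C → P b v`.

Proof: `S` is a complete metric space, hence Baire; the closed sets
`closure {v ∈ S | P (1/(m+1)) v}`, `m ∈ ℕ`, cover `S` (cover + antitone), so one of them contains a
ball `B_S(v₀, r)` (Baire), on which `P (b_m/2)` holds (closure); for `h ∈ S`, `‖h‖ < r`,
`h = (v₀ + h) + (−v₀)` gives `P (b_m/4) h` (symmetry + sum); scaling by `c = r/(2(C+1))` transports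
this to the ball of radius `C`. In the application (sum) and (closure) are Hölder in the observable
(with the static one-site Gaussian bound pricing small perturbations), (symmetry) is `β ↦ −β`,
(scaling) is `β ↦ cβ`, and (cover) is the crux.

References: standard (Banach–Steinhaus-type uniform boundedness via the Baire category theorem,
e.g. W. Rudin, *Functional Analysis* (1991), Thm 2.5 and its proof).
-/

noncomputable section

open Set Filter Metric Topology

namespace Summit.AtomisticToContinuum.HydrodynamicLimit.Theorems.FastWindowRG

/-- **Automatic uniformity of a tilt range (Baire).** See the module docstring. [folklore] -/
theorem exists_uniform_range_of_baire :
    ∀ {E : Type} [NormedAddCommGroup E] [NormedSpace ℝ E] [CompleteSpace E] {S : Set E},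
    IsClosed S → (0 : E) ∈ S → (∀ v ∈ S, ∀ w ∈ S, v + w ∈ S) → (∀ v ∈ S, -v ∈ S) →
    (∀ (c : ℝ), ∀ v ∈ S, c • v ∈ S) →
    ∀ (P : ℝ → E → Prop),
    (∀ v ∈ S, ∃ b : ℝ, 0 < b ∧ P b v) →
    (∀ (b b' : ℝ) (v : E), P b v → 0 < b' → b' ≤ b → P b' v) →
    (∀ b : ℝ, 0 < b → ∀ v ∈ S, (∀ δ : ℝ, 0 < δ → ∃ w ∈ S, ‖w - v‖ < δ ∧ P b w) → P (b / 2) v) →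
    (∀ b : ℝ, 0 < b → ∀ v w : E, P b v → P b w → P (b / 2) (v + w)) →
    (∀ (b : ℝ) (v : E), P b v → P b (-v)) →
    (∀ (b c : ℝ) (v : E), 0 < c → P b v → P (b / c) (c • v)) →
    ∀ C : ℝ, 0 ≤ C → ∃ b : ℝ, 0 < b ∧ ∀ v ∈ S, ‖v‖ ≤ C → P b v := by
  intro E _ _ _ S hS h0 hSadd hSneg hSsmul P hcover hanti hclosure hadd hneg hsmul C hC
  -- `S` as a complete metric space, hence a Baire space
  haveI : CompleteSpace S := hS.completeSpace_coe
  haveI : Nonempty S := ⟨⟨0, h0⟩⟩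
  -- the closed cover
  set f : ℕ → Set S := fun m => closure {x : S | P (1 / ((m : ℝ) + 1)) (x : E)} with hf
  have hfc : ∀ m, IsClosed (f m) := fun m => isClosed_closure
  have hfU : (⋃ m, f m) = univ := by
    refine eq_univ_of_forall fun x => ?_
    obtain ⟨b, hb, hPb⟩ := hcover (x : E) x.2
    obtain ⟨m, hm⟩ := exists_nat_one_div_lt hb
    refine mem_iUnion.2 ⟨m, subset_closure ?_⟩
    exact hanti b _ _ hPb (by positivity) hm.le
  -- Baire: one of the closed sets has an interior point, hence contains a ball
  obtain ⟨m, x₀, hx₀⟩ := nonempty_interior_of_iUnion_of_closed hfc hfU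
  obtain ⟨r, hr, hball⟩ := Metric.mem_nhds_iff.1 (mem_interior_iff_mem_nhds.1 hx₀)
  set b : ℝ := 1 / ((m : ℝ) + 1) with hb
  have hb0 : 0 < b := by positivity
  -- on the ball, `P (b/2)` holds (closure hypothesis)
  have hQ1 : ∀ v ∈ S, ‖v - (x₀ : E)‖ < r → P (b / 2) v := by
    intro v hv hvr
    have hmem : (⟨v, hv⟩ : S) ∈ f m := by
      apply hball
      rw [Metric.mem_ball, Subtype.dist_eq, dist_eq_norm]
      exact hvr
    refine hclosure b hb0 v hv fun δ hδ => ?_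
    obtain ⟨w, hw, hdist⟩ := Metric.mem_closure_iff.1 hmem δ hδ
    refine ⟨(w : E), w.2, ?_, hw⟩
    rw [Subtype.dist_eq, dist_eq_norm, ← norm_neg, neg_sub] at hdist
    exact hdist
  -- small elements of `S`: `h = (x₀ + h) + (-x₀)`
  have hQ2 : ∀ h ∈ S, ‖h‖ < r → P (b / 2 / 2) h := by
    intro h hh hhr
    have h1 : P (b / 2) ((x₀ : E) + h) := by
      refine hQ1 _ (hSadd _ x₀.2 _ hh) ?_
      rwa [add_sub_cancel_left]
    have h2 : P (b / 2) (-(x₀ : E)) := by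
      refine hneg _ _ (hQ1 _ x₀.2 ?_)
      rwa [sub_self, norm_zero]
    have h3 := hadd (b / 2) (half_pos hb0) _ _ h1 h2
    rwa [add_neg_cancel_comm] at h3
  -- transport to the ball of radius `C` by scaling
  set c : ℝ := r / (2 * (C + 1)) with hc
  have hc0 : 0 < c := by positivity
  refine ⟨b / 2 / 2 / c⁻¹, by positivity, fun v hv hvC => ?_⟩
  have hcv : ‖c • v‖ < r := by
    rw [norm_smul, Real.norm_eq_abs, abs_of_pos hc0, hc]
    have h1 : r / (2 * (C + 1)) * ‖v‖ ≤ r / (2 * (C + 1)) * C :=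
      mul_le_mul_of_nonneg_left hvC (by positivity)
    have h2 : r / (2 * (C + 1)) * C < r := by
      rw [div_mul_eq_mul_div, div_lt_iff₀ (by positivity)]
      nlinarith
    exact h1.trans_lt h2
  have h := hsmul (b / 2 / 2) c⁻¹ (c • v) (inv_pos.2 hc0) (hQ2 _ (hSsmul c v hv) hcv)
  rwa [smul_smul, inv_mul_cancel₀ hc0.ne', one_smul] at h

end Summit.AtomisticToContinuum.HydrodynamicLimit.Theorems.FastWindowRG

end
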